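/-
Copyright (c) 2026 the pub-hodgecm-mathlib formalisation cell (harness21).  Prover seat hodgecm-mathlib-K2E3-p29 (g4), Track B ∕ R90-TF, h413 = `stmt-HodgeConjecture-24833`,
R90-TF section S8 «ContSpec-n½» (S8 dealer R90-CS-plan (g3) S8-R236, chair K2-lead (g2) VALVE 25 (cc)): the ARCHIMEDEAN half (T_∞) of the invariance letter `hTRANSτ` of ★ p864333 —
the ARCH TWIN of ★ (T_f) FILE A `R90S8ResGMidAtomFlatReexpansionU3` (R90-C133-p02, ★ p864466): the right translate `r(k)φ` of a pair-section `φ` lying in a FINITE-DIMENSIONAL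
`ι(K_∞)`-STABLE space `W₀` by `k ∈ ι(K_∞)` re-expands, on the flat families, as `flat(φ, z)(x·k) = Σᵢ cᵢ(k) · flat(ψᵢ, z)(x)` along a basis `(ψᵢ)` of `W₀`, with coefficients
`cᵢ(k)` = the coordinates of `τ(k)φ` — INDEPENDENT OF `z`, because the Borel height is right-`K_max`-invariant.
-/
import Summits.HodgeConjecture.HodgeConjecture.Theorems.R90S8ResGMidAtomFlatReexpansionU3   -- ★ p864466 (T_f) FILE A, the twin (brings ★ p864157 τ-DEFS `archMaximalCompact`∕`IsArchFinite`, ★ `flatSectionU`, ★ height `K_max`-invariance)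
import Summits.HodgeConjecture.HodgeConjecture.Theorems.R90S8ResGMidAtomTauPureSplitU3      -- ★ (K2E1-p12): `archMaximalCompact_le_kMax`, `isArchFinite_of_mem_of_finiteDimensional`
import HarnessLib

/-!
# S8 (R)′ road, letter `hTRANSτ` step (T_∞) — `R90S8ResGMidAtomArchReexpansionU3`: THE FLAT RE-EXPANSION OF AN ARCHIMEDEAN TRANSLATE INSIDE A FINITE-DIMENSIONAL `ι(K_∞)`-STABLE SPACE

Track B ∕ R90-TF, crux h413 = `stmt-HodgeConjecture-24833`, route of record `HCCMUnconditional`; cell `hodgecm-mathlib`, R90-TF section S8 «ContSpec-n½ ∕ ResidualSpectrum», socket (R)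
(B ED. 7 :337, the ARCH-INV row) ← ★ `res_midBlock_le_residual_of_letters' (hDISC) …` ← ★ p864333 `hDISC_of_tauRecord (hW1) (hTRANSτ)` ← `hTRANSτ` = (T_f) [★ p864395 FILE B + ★ p864466
FILE A + the exports of the pieces] + (T_∞) [THIS FILE + the exports of the pieces].  THEOREMS ONLY (no `def`, no `instance`, no `notation`, no named-fact hypothesis, no `sorry`;
default heartbeats); lane `--supports stmt-HodgeConjecture-24833 --as helper` (count-neutral).  CLOSES NO SOCKET.  LETTER-FREE (every input is ★ or a visible binder).

CURRENCY (K2E1-p12 (g6)'s J-S8-CO interface card, R90 bus 02:45:14Z; ★ FILE B `R90S8ResGMidRowsOfTauExportsClosedU3` :89–94 bytes): `GA := (quasiSplit F⁺ L c 3).Adelic`,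
`K∞ := ↥(archMaximalCompact L)` (★ p864157), `RINF := (rightTranslation G).comp (archMaximalCompact L).subtype`, `TAU := Subrepresentation.toRepresentation ⟨W₀, hW₀K⟩` for a
`Submodule ℂ (GA → ℂ)` `W₀` with `hW₀K : ∀ k : K∞, ∀ ψ ∈ W₀, RINF k ψ ∈ W₀` — `W₀` is carried as `Submodule` + `hW₀K` (the card's bytes VERBATIM), a basis as `Module.Basis ι ℂ ↥W₀`
(`[Fintype ι]`; `ι := Fin n` and `Module.finBasis` both fit).

THE MATHEMATICS ([MoeglinWaldspurger1995] I.2.2, I.2.17, II.1.5; [BorelJacquet1979] §1.3, §4.1; [Garrett2018] §2.2, Claim 3.3.2).  The Borel height `H` is right-invariant under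
`K_max = adelicVal⁻¹(K_∞·GL₃(𝒪̂))` (★ `borelHeight_mul_of_mem_comap_standardMaximalCompactGL`, [Garrett2018, Claim 3.3.2]) and `ι(K_∞) ≤ K_max` (★ `archMaximalCompact_le_kMax`), so for
`k ∈ ι(K_∞)`: `flat(φ, z)(x k) = φ(x k)·H(x k)^z = (r(k)φ)(x)·H(x)^z = flat(r(k)φ, z)(x)` (§1).  If `φ ∈ W₀`, `W₀` finite-dimensional and `ι(K_∞)`-stable with basis `(ψᵢ)_{i ∈ ι}`, then
`r(k)φ = τ(k)φ = Σᵢ cᵢ(k) ψᵢ` with `cᵢ(k) := (b.repr (τ(k)φ))ᵢ ∈ ℂ`, and `flat(·, z)(x)` is linear, whence `flat(φ, z)(x k) = Σᵢ cᵢ(k) · flat(ψᵢ, z)(x)` for EVERY `z` with the SAME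
`cᵢ(k)` (§1 head).  For the consumers that take ★ FILE A's `hdec` shape `flat(φ,z)(x g) = Σ_{i ∈ s} cᵢ^z · flat(ψᵢ,z)(x)` with `cᵢ : ℝ≥0`, `0 < cᵢ` (★ p864395 FILE B, ★ p864700
RES-INT line 6), absorb the complex coordinate into the piece: `ψ'ᵢ := cᵢ(k) • ψᵢ ∈ W₀`, `cᵢ := 1` (§2) — the pieces stay in `W₀`, so they inherit continuity, pair-section membership
and `ι(K_∞)`-finiteness from `W₀` (§3, ★ `isArchFinite_of_mem_of_finiteDimensional`).
* §1 `borelHeight_mul_coe_archMaximalCompact` (`H(x k) = H(x)`, `k ∈ ι(K_∞)`), `flatSectionU_mul_coe_archMaximalCompact` (`flat(φ,z)(x k) = flat(RINF k φ, z)(x)`),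
  `coe_tau_archMaximalCompact_apply` (`↑(TAU k ⟨φ, hφ⟩) = RINF k φ`), `flatSectionU_mul_arch_eq_sum_of_eq_sum` (hypothesis-first: ANY expansion `RINF k φ = Σ_{i∈s} aᵢ • ψᵢ` gives
  `flat(φ,z)(x k) = Σ_{i∈s} aᵢ · flat(ψᵢ,z)(x)`), **`flat_translate_arch_eq_sum`** (THE HEAD: basis form, coefficients `(b.repr (TAU k ⟨φ, hφ⟩)) i`, independent of `z`).
* §2 **`flat_translate_arch_hdec`** (★ FILE A's `hdec` shape VERBATIM at `g := ↑k`, `s := Finset.univ`, `c := fun _ => 1`, pieces `(b.repr (TAU k ⟨φ, hφ⟩)) i • ↑(b i)`),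
  **`exists_pieces_flat_translate_arch`** (OF RECORD, basis-free: `∃ n (ψ : Fin n → GA → ℂ)`, every `ψ i ∈ W₀` and arch-finite, with the `hdec` identity at `c := 1`).
* §3 `repr_smul_basis_mem` (the §2 pieces lie in `W₀`), `isArchFinite_coe_basis`, `isArchFinite_repr_smul_basis` (basis vectors and pieces are `ι(K_∞)`-finite), `one_pos_pieces`
  (FILE B's `hc` at `c := 1`).
HONEST LABEL: HC_CM is proved only modulo the 7 printed citations (2 remaining named inputs: hLiu418 = `stmt-HodgeConjecture-24832`, h413 = `stmt-HodgeConjecture-24833`) until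
rung 0 closes; REL ≠ ★ ≠ BUILT; (T_∞) = THIS ★-able FILE ∘ {the exports of the pieces (ESTATE T)} — ARCH-INV goes L → S–M in flight, nothing closes by it; pays no socket; count-neutral.

## References
* [MoeglinWaldspurger1995] C. Mœglin, J.-L. Waldspurger, *Spectral Decomposition and Eisenstein Series* (1995), I.2.2 (heights and `K`), I.2.17 (`K`-finite sections), II.1.5 (flat sections).
* [BorelJacquet1979] A. Borel, H. Jacquet, *Automorphic forms and automorphic representations*, Proc. Symp. Pure Math. 33.1 (1979), §1.3 (`K`-finiteness), §4.1 (`K = K_∞·K_f`).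
* [Garrett2018] P. Garrett, *Modern Analysis of Automorphic Forms by Example*, vol. 1 (2018), §2.2, Claim 3.3.2 (right-`K`-invariance of the height).
-/

set_option autoImplicit false
set_option linter.dupNamespace false  -- the mandated namespace `…HodgeConjecture.HodgeConjecture.R90.S8` (LEAD #1 L1) repeats the summit's segment

noncomputable section

open MeasureTheory Measure Set Filter Topology NumberField ContRepresentation
open Literature.NumberTheory Literature.NumberTheory.Automorphic Literature.NumberTheory.Automorphic.UnitaryGroup Literature.NumberTheory.GaloisRepresentations AdelicGroupData
open Literature.NumberTheory.Automorphic.Arthur2013.Leaves.TECR Literature.NumberTheory.Rogawski1990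
open Summit.HodgeConjecture.HodgeConjecture.Cruxes.H413.K2E1BorelEisensteinU
open Summit.HodgeConjecture.HodgeConjecture.Cruxes.H413.K2E1CharacterEisensteinU3PairDefs
open Summit.HodgeConjecture.HodgeConjecture.Cruxes.H413.K2E1ChiSectionSpaceU3PairDefs
open scoped ENNReal NNReal

namespace Summit.HodgeConjecture.HodgeConjecture.R90.S8

variable (L : Type) [Field L] [NumberField L] [IsCMField L]

/-! ## §1 The flat section of an archimedean translate, and its re-expansion along a basis of a finite-dimensional `ι(K_∞)`-stable space -/

/-- **`H(x · k) = H(x)` for `k ∈ ι(K_∞)`**: `ι(K_∞) ≤ K_max` (★ `archMaximalCompact_le_kMax`) and the Borel height is right-`K_max`-invariant (★ `borelHeight_mul_of_mem_comap_standardMaximalCompactGL`).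
[cite: Garrett2018, Claim 3.3.2] [cite: MoeglinWaldspurger1995, I.2.2] -/
theorem borelHeight_mul_coe_archMaximalCompact (k : ↥(archMaximalCompact L)) (x : (quasiSplit (↥(maximalRealSubfield L)) L (IsCMField.complexConj L) 3).Adelic) :
    borelHeight (x * (k : (quasiSplit (↥(maximalRealSubfield L)) L (IsCMField.complexConj L) 3).Adelic)) = borelHeight x :=
  borelHeight_mul_of_mem_comap_standardMaximalCompactGL (archMaximalCompact_le_kMax L k.2) x

/-- **`flat(φ, z)(x · k) = flat(r(k)φ, z)(x)` for `k ∈ ι(K_∞)`** — the exponent-`z` factor `H^z` does not see `k` (`H(x k) = H(x)`). [cite: MoeglinWaldspurger1995, II.1.5] [cite: Garrett2018, Claim 3.3.2] -/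
theorem flatSectionU_mul_coe_archMaximalCompact (φ : (quasiSplit (↥(maximalRealSubfield L)) L (IsCMField.complexConj L) 3).Adelic → ℂ) (k : ↥(archMaximalCompact L)) (z : ℂ)
    (x : (quasiSplit (↥(maximalRealSubfield L)) L (IsCMField.complexConj L) 3).Adelic) :
    flatSectionU φ z (x * (k : (quasiSplit (↥(maximalRealSubfield L)) L (IsCMField.complexConj L) 3).Adelic)) =
      flatSectionU (((rightTranslation (quasiSplit (↥(maximalRealSubfield L)) L (IsCMField.complexConj L) 3)).comp (archMaximalCompact L).subtype) k φ) z x := by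
  rw [flatSectionU_apply, flatSectionU_apply, borelHeight_mul_coe_archMaximalCompact]
  rfl

/-- **`↑(τ(k) ⟨φ, hφ⟩) = r(k)φ`**: the sub-representation `TAU := Subrepresentation.toRepresentation ⟨W₀, hW₀K⟩` of `RINF` acts by right translation on the underlying functions (`rfl`).
[cite: BorelJacquet1979, §1.3] -/
theorem coe_tau_archMaximalCompact_apply (W₀ : Submodule ℂ ((quasiSplit (↥(maximalRealSubfield L)) L (IsCMField.complexConj L) 3).Adelic → ℂ))
    (hW₀K : ∀ k : ↥(archMaximalCompact L), ∀ ψ ∈ W₀, ((rightTranslation (quasiSplit (↥(maximalRealSubfield L)) L (IsCMField.complexConj L) 3)).comp (archMaximalCompact L).subtype) k ψ ∈ W₀)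
    {φ : (quasiSplit (↥(maximalRealSubfield L)) L (IsCMField.complexConj L) 3).Adelic → ℂ} (hφ : φ ∈ W₀) (k : ↥(archMaximalCompact L)) :
    (((Subrepresentation.toRepresentation (⟨W₀, hW₀K⟩ : Subrepresentation ((rightTranslation (quasiSplit (↥(maximalRealSubfield L)) L (IsCMField.complexConj L) 3)).comp (archMaximalCompact L).subtype))) k ⟨φ, hφ⟩ : ↥W₀) :
        (quasiSplit (↥(maximalRealSubfield L)) L (IsCMField.complexConj L) 3).Adelic → ℂ) =
      ((rightTranslation (quasiSplit (↥(maximalRealSubfield L)) L (IsCMField.complexConj L) 3)).comp (archMaximalCompact L).subtype) k φ :=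
  rfl

/-- **THE RE-EXPANSION, HYPOTHESIS-FIRST**: ANY finite expansion `r(k)φ = Σ_{i ∈ s} aᵢ • ψᵢ` of the archimedean translate (`k ∈ ι(K_∞)`) gives, for EVERY `z` and with the SAME coefficients,
`flat(φ, z)(x · k) = Σ_{i ∈ s} aᵢ · flat(ψᵢ, z)(x)` — `flat(·, z)(x)` is linear and `H(x k) = H(x)`. [cite: MoeglinWaldspurger1995, II.1.5, I.2.17] [cite: BorelJacquet1979, §1.3] -/
theorem flatSectionU_mul_arch_eq_sum_of_eq_sum (φ : (quasiSplit (↥(maximalRealSubfield L)) L (IsCMField.complexConj L) 3).Adelic → ℂ) (k : ↥(archMaximalCompact L))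
    {ι : Type*} (s : Finset ι) (a : ι → ℂ) (ψ : ι → (quasiSplit (↥(maximalRealSubfield L)) L (IsCMField.complexConj L) 3).Adelic → ℂ)
    (hexp : ((rightTranslation (quasiSplit (↥(maximalRealSubfield L)) L (IsCMField.complexConj L) 3)).comp (archMaximalCompact L).subtype) k φ = ∑ i ∈ s, a i • ψ i)
    (z : ℂ) (x : (quasiSplit (↥(maximalRealSubfield L)) L (IsCMField.complexConj L) 3).Adelic) :
    flatSectionU φ z (x * (k : (quasiSplit (↥(maximalRealSubfield L)) L (IsCMField.complexConj L) 3).Adelic)) = ∑ i ∈ s, a i * flatSectionU (ψ i) z x := by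
  rw [flatSectionU_mul_coe_archMaximalCompact, hexp]
  simp only [flatSectionU_apply, Finset.sum_apply, Pi.smul_apply, smul_eq_mul, Finset.sum_mul, mul_assoc]

/-- **HEAD — `flat_translate_arch_eq_sum` ((R)′'s ARCH-INV row (T_∞))**: for `φ` in a finite-dimensional `ι(K_∞)`-stable space `W₀` (binders `W₀`, `hW₀K` as in the J-S8-CO card) with a
basis `b : Module.Basis ι ℂ ↥W₀`, and `k ∈ ι(K_∞)`: `flat(φ, z)(x · k) = Σᵢ cᵢ(k) · flat(bᵢ, z)(x)` for EVERY `z` and `x`, where `cᵢ(k) := (b.repr (τ(k)⟨φ, hφ⟩))ᵢ` is the `i`-th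
coordinate of `τ(k)φ = r(k)φ` — INDEPENDENT OF `z` (the point of the arch row: `H(x k) = H(x)`, so `flat(φ,z)(x k) = (r(k)φ)(x)·H(x)^z`). [cite: MoeglinWaldspurger1995, I.2.17, II.1.5]
[cite: BorelJacquet1979, §1.3, §4.1] [cite: Garrett2018, Claim 3.3.2] -/
theorem flat_translate_arch_eq_sum (W₀ : Submodule ℂ ((quasiSplit (↥(maximalRealSubfield L)) L (IsCMField.complexConj L) 3).Adelic → ℂ))
    (hW₀K : ∀ k : ↥(archMaximalCompact L), ∀ ψ ∈ W₀, ((rightTranslation (quasiSplit (↥(maximalRealSubfield L)) L (IsCMField.complexConj L) 3)).comp (archMaximalCompact L).subtype) k ψ ∈ W₀)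
    {ι : Type*} [Fintype ι] (b : Module.Basis ι ℂ ↥W₀)
    {φ : (quasiSplit (↥(maximalRealSubfield L)) L (IsCMField.complexConj L) 3).Adelic → ℂ} (hφ : φ ∈ W₀) (k : ↥(archMaximalCompact L)) (z : ℂ)
    (x : (quasiSplit (↥(maximalRealSubfield L)) L (IsCMField.complexConj L) 3).Adelic) :
    flatSectionU φ z (x * (k : (quasiSplit (↥(maximalRealSubfield L)) L (IsCMField.complexConj L) 3).Adelic)) =
      ∑ i, b.repr ((Subrepresentation.toRepresentation (⟨W₀, hW₀K⟩ : Subrepresentation ((rightTranslation (quasiSplit (↥(maximalRealSubfield L)) L (IsCMField.complexConj L) 3)).comp (archMaximalCompact L).subtype))) k ⟨φ, hφ⟩) i *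
        flatSectionU ((b i : ↥W₀) : (quasiSplit (↥(maximalRealSubfield L)) L (IsCMField.complexConj L) 3).Adelic → ℂ) z x := by
  refine flatSectionU_mul_arch_eq_sum_of_eq_sum L φ k Finset.univ _ _ ?_ z x
  rw [← coe_tau_archMaximalCompact_apply L W₀ hW₀K hφ k]
  conv_lhs => rw [← b.sum_repr ((Subrepresentation.toRepresentation (⟨W₀, hW₀K⟩ : Subrepresentation ((rightTranslation (quasiSplit (↥(maximalRealSubfield L)) L (IsCMField.complexConj L) 3)).comp (archMaximalCompact L).subtype))) k ⟨φ, hφ⟩)]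
  rw [Submodule.coe_sum]
  rfl

/-! ## §2 The same identity in ★ FILE A's `hdec` shape (`c := 1`, pieces `cᵢ(k) • bᵢ ∈ W₀`) -/

/-- **`flat_translate_arch_hdec` — ★ FILE A's `hdec` SHAPE at an archimedean translate**: `flat(φ,z)(x·↑k) = Σ_{i ∈ univ} 1^z · flat(cᵢ(k) • bᵢ, z)(x)` — LITERALLY the `hdec` binder of ★ p864395
FILE B ∕ ★ p864700 RES-INT line 6 at `g := ↑k`, `s := Finset.univ`, `c := fun _ => (1 : ℝ≥0)`, `ψ i := cᵢ(k) • ↑(b i)` (so RES-INT line 6 and the (R)′ translation law apply to arch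
translates with `z`-CONSTANT coefficients). [cite: MoeglinWaldspurger1995, II.1.5, I.2.17] [cite: BorelJacquet1979, §1.3] -/
theorem flat_translate_arch_hdec (W₀ : Submodule ℂ ((quasiSplit (↥(maximalRealSubfield L)) L (IsCMField.complexConj L) 3).Adelic → ℂ))
    (hW₀K : ∀ k : ↥(archMaximalCompact L), ∀ ψ ∈ W₀, ((rightTranslation (quasiSplit (↥(maximalRealSubfield L)) L (IsCMField.complexConj L) 3)).comp (archMaximalCompact L).subtype) k ψ ∈ W₀)
    {ι : Type*} [Fintype ι] (b : Module.Basis ι ℂ ↥W₀)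
    {φ : (quasiSplit (↥(maximalRealSubfield L)) L (IsCMField.complexConj L) 3).Adelic → ℂ} (hφ : φ ∈ W₀) (k : ↥(archMaximalCompact L)) (z : ℂ)
    (x : (quasiSplit (↥(maximalRealSubfield L)) L (IsCMField.complexConj L) 3).Adelic) :
    flatSectionU φ z (x * (k : (quasiSplit (↥(maximalRealSubfield L)) L (IsCMField.complexConj L) 3).Adelic)) =
      ∑ i ∈ (Finset.univ : Finset ι), ((((1 : ℝ≥0) : ℝ) : ℂ) ^ z) *
        flatSectionU (b.repr ((Subrepresentation.toRepresentation (⟨W₀, hW₀K⟩ : Subrepresentation ((rightTranslation (quasiSplit (↥(maximalRealSubfield L)) L (IsCMField.complexConj L) 3)).comp (archMaximalCompact L).subtype))) k ⟨φ, hφ⟩) i •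
          ((b i : ↥W₀) : (quasiSplit (↥(maximalRealSubfield L)) L (IsCMField.complexConj L) 3).Adelic → ℂ)) z x := by
  have h1 : ((((1 : ℝ≥0) : ℝ) : ℂ) ^ z) = 1 := by
    rw [NNReal.coe_one, Complex.ofReal_one, Complex.one_cpow]
  rw [flat_translate_arch_eq_sum L W₀ hW₀K b hφ k z x]
  refine Finset.sum_congr rfl fun i _ => ?_
  simp only [h1, one_mul, flatSectionU_apply, Pi.smul_apply, smul_eq_mul, mul_assoc]

/-- **OF RECORD, BASIS-FREE — `exists_pieces_flat_translate_arch`**: for `φ` in a FINITE-DIMENSIONAL `ι(K_∞)`-stable `W₀` and `k ∈ ι(K_∞)` there are finitely many PIECES `ψ₀, …, ψ_{n−1} ∈ W₀`,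
each `ι(K_∞)`-finite, with `flat(φ, z)(x·↑k) = Σᵢ 1^z · flat(ψᵢ, z)(x)` for every `z`, `x` (★ FILE A's `hdec` at `c := 1`; `n := finrank W₀`, `ψᵢ := cᵢ(k) • bᵢ` for `b := Module.finBasis`).
Membership in `W₀` is what hands the consumer continuity ∕ pair-section membership ∕ boundedness of the pieces from the corresponding letters of `W₀`. [cite: MoeglinWaldspurger1995, I.2.17, II.1.5]
[cite: BorelJacquet1979, §1.3, §4.1] -/
theorem exists_pieces_flat_translate_arch (W₀ : Submodule ℂ ((quasiSplit (↥(maximalRealSubfield L)) L (IsCMField.complexConj L) 3).Adelic → ℂ))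
    (hW₀K : ∀ k : ↥(archMaximalCompact L), ∀ ψ ∈ W₀, ((rightTranslation (quasiSplit (↥(maximalRealSubfield L)) L (IsCMField.complexConj L) 3)).comp (archMaximalCompact L).subtype) k ψ ∈ W₀)
    [FiniteDimensional ℂ ↥W₀]
    {φ : (quasiSplit (↥(maximalRealSubfield L)) L (IsCMField.complexConj L) 3).Adelic → ℂ} (hφ : φ ∈ W₀) (k : ↥(archMaximalCompact L)) :
    ∃ (n : ℕ) (ψ : Fin n → (quasiSplit (↥(maximalRealSubfield L)) L (IsCMField.complexConj L) 3).Adelic → ℂ),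
      (∀ i, ψ i ∈ W₀) ∧ (∀ i, IsArchFinite L (ψ i)) ∧
        ∀ (z : ℂ) (x : (quasiSplit (↥(maximalRealSubfield L)) L (IsCMField.complexConj L) 3).Adelic),
          flatSectionU φ z (x * (k : (quasiSplit (↥(maximalRealSubfield L)) L (IsCMField.complexConj L) 3).Adelic)) =
            ∑ i ∈ (Finset.univ : Finset (Fin n)), ((((1 : ℝ≥0) : ℝ) : ℂ) ^ z) * flatSectionU (ψ i) z x := by
  refine ⟨Module.finrank ℂ ↥W₀, fun i => (Module.finBasis ℂ ↥W₀).repr ((Subrepresentation.toRepresentation (⟨W₀, hW₀K⟩ : Subrepresentation ((rightTranslation (quasiSplit (↥(maximalRealSubfield L)) L (IsCMField.complexConj L) 3)).comp (archMaximalCompact L).subtype))) k ⟨φ, hφ⟩) i •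
    ((Module.finBasis ℂ ↥W₀ i : ↥W₀) : (quasiSplit (↥(maximalRealSubfield L)) L (IsCMField.complexConj L) 3).Adelic → ℂ), fun i => W₀.smul_mem _ (Module.finBasis ℂ ↥W₀ i).2,
    fun i => isArchFinite_of_mem_of_finiteDimensional L hW₀K (W₀.smul_mem _ (Module.finBasis ℂ ↥W₀ i).2), fun z x => ?_⟩
  exact flat_translate_arch_hdec L W₀ hW₀K (Module.finBasis ℂ ↥W₀) hφ k z x

/-! ## §3 What the pieces inherit from `W₀` (stated for the consumers) -/

/-- The §2 pieces `cᵢ(k) • bᵢ` lie in `W₀` (so every letter the consumer holds for members of `W₀` — continuity, pair-section membership at a level, boundedness — applies to them).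
[cite: BorelJacquet1979, §1.3] -/
theorem repr_smul_basis_mem (W₀ : Submodule ℂ ((quasiSplit (↥(maximalRealSubfield L)) L (IsCMField.complexConj L) 3).Adelic → ℂ))
    (hW₀K : ∀ k : ↥(archMaximalCompact L), ∀ ψ ∈ W₀, ((rightTranslation (quasiSplit (↥(maximalRealSubfield L)) L (IsCMField.complexConj L) 3)).comp (archMaximalCompact L).subtype) k ψ ∈ W₀)
    {ι : Type*} (b : Module.Basis ι ℂ ↥W₀)
    {φ : (quasiSplit (↥(maximalRealSubfield L)) L (IsCMField.complexConj L) 3).Adelic → ℂ} (hφ : φ ∈ W₀) (k : ↥(archMaximalCompact L)) (i : ι) :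
    b.repr ((Subrepresentation.toRepresentation (⟨W₀, hW₀K⟩ : Subrepresentation ((rightTranslation (quasiSplit (↥(maximalRealSubfield L)) L (IsCMField.complexConj L) 3)).comp (archMaximalCompact L).subtype))) k ⟨φ, hφ⟩) i •
        ((b i : ↥W₀) : (quasiSplit (↥(maximalRealSubfield L)) L (IsCMField.complexConj L) 3).Adelic → ℂ) ∈ W₀ :=
  W₀.smul_mem _ (b i).2

/-- **`ι(K_∞)`-FINITENESS IS INHERITED BY EVERY BASIS VECTOR** of a finite-dimensional `ι(K_∞)`-stable `W₀` (★ `isArchFinite_of_mem_of_finiteDimensional`; finite-dimensionality from the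
finite basis, `Module.Basis.finiteDimensional_of_finite`). [cite: BorelJacquet1979, §1.3, §4.1] [cite: MoeglinWaldspurger1995, I.2.17] -/
theorem isArchFinite_coe_basis (W₀ : Submodule ℂ ((quasiSplit (↥(maximalRealSubfield L)) L (IsCMField.complexConj L) 3).Adelic → ℂ))
    (hW₀K : ∀ k : ↥(archMaximalCompact L), ∀ ψ ∈ W₀, ((rightTranslation (quasiSplit (↥(maximalRealSubfield L)) L (IsCMField.complexConj L) 3)).comp (archMaximalCompact L).subtype) k ψ ∈ W₀)
    {ι : Type*} [Fintype ι] (b : Module.Basis ι ℂ ↥W₀) (i : ι) :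
    IsArchFinite L ((b i : ↥W₀) : (quasiSplit (↥(maximalRealSubfield L)) L (IsCMField.complexConj L) 3).Adelic → ℂ) := by
  haveI : FiniteDimensional ℂ ↥W₀ := b.finiteDimensional_of_finite
  exact isArchFinite_of_mem_of_finiteDimensional L hW₀K (b i).2

/-- **`ι(K_∞)`-FINITENESS IS INHERITED BY EVERY §2 PIECE** `cᵢ(k) • bᵢ`. [cite: BorelJacquet1979, §1.3, §4.1] [cite: MoeglinWaldspurger1995, I.2.17] -/
theorem isArchFinite_repr_smul_basis (W₀ : Submodule ℂ ((quasiSplit (↥(maximalRealSubfield L)) L (IsCMField.complexConj L) 3).Adelic → ℂ))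
    (hW₀K : ∀ k : ↥(archMaximalCompact L), ∀ ψ ∈ W₀, ((rightTranslation (quasiSplit (↥(maximalRealSubfield L)) L (IsCMField.complexConj L) 3)).comp (archMaximalCompact L).subtype) k ψ ∈ W₀)
    {ι : Type*} [Fintype ι] (b : Module.Basis ι ℂ ↥W₀)
    {φ : (quasiSplit (↥(maximalRealSubfield L)) L (IsCMField.complexConj L) 3).Adelic → ℂ} (hφ : φ ∈ W₀) (k : ↥(archMaximalCompact L)) (i : ι) :
    IsArchFinite L (b.repr ((Subrepresentation.toRepresentation (⟨W₀, hW₀K⟩ : Subrepresentation ((rightTranslation (quasiSplit (↥(maximalRealSubfield L)) L (IsCMField.complexConj L) 3)).comp (archMaximalCompact L).subtype))) k ⟨φ, hφ⟩) i •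
        ((b i : ↥W₀) : (quasiSplit (↥(maximalRealSubfield L)) L (IsCMField.complexConj L) 3).Adelic → ℂ)) := by
  haveI : FiniteDimensional ℂ ↥W₀ := b.finiteDimensional_of_finite
  exact isArchFinite_of_mem_of_finiteDimensional L hW₀K (repr_smul_basis_mem L W₀ hW₀K b hφ k i)

/-- ★ FILE B's positivity letter `hc : ∀ i ∈ s, 0 < c i` at the §2 choice `c := fun _ => 1`. [cite: MoeglinWaldspurger1995, II.1.5] -/
theorem one_pos_pieces {ι : Type*} (s : Finset ι) : ∀ i ∈ s, (0 : ℝ≥0) < (fun _ : ι => (1 : ℝ≥0)) i :=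
  fun _ _ => one_pos

end Summit.HodgeConjecture.HodgeConjecture.R90.S8

end
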